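import Summits.BirchSwinnertonDyer.Rank1Residual.X9.SurjBigImage
import Summits.BirchSwinnertonDyer.Rank1Residual.Partition.Bsdp
import HarnessLib

/-!
# Partition lemma, finding F2 closed: the printed class X9im IS the tree's X9, so the residual
# classes of record are X1–X12 ∪ X11b (cell `b2b-bsdres`, unit `b2b-bsdres-x9`, gen 9)

HONEST FRAMING (run/shared/lean/b2b/bsd-rank1-residual/, verbatim in every file): the goal of the
cell is to DELETE the COMBINATION-SHAPED residual classes of the Birch–Swinnerton-Dyer formula for
ALL analytic-rank `≤ 1` elliptic curves over `ℚ` — "full BSD formula for every rank `≤ 1` curve in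
class `C`" assembled STRICTLY from published theorems — so that the rank-`≤ 1` remainder becomes
exactly the CONSTRUCTION-SHAPED classes, which are TYPED (missing-input `Prop`s), NOT attempted.
This is not "finishing BSD". Nothing here is a class theorem; no named fact; X9 stays typed.

The partition lemma (`Summits/BirchSwinnertonDyer/Rank1Residual/Partition.lean`, lit seat gen 12,
p198914; referee acceptance test CLASS-OWNERS.md points 1–10) states `partition : r_an(E) ≤ 1 →
Covered W p ∨ Residual W p` with `Residual = ClassX1 ∨ … ∨ ClassX12 ∨ ClassX9im ∨ ClassX11a ∨
ClassX11b`, and records as finding F2 that the cell `(¬cm, ord, p ≥ 5, irr, surj, ¬(im))` is in no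
tree class — "EMPTY for real curves (Serre 1968 IV-23 Lemma 3 … the step to (im) is not in the
tree), so this file uses the printed predicate `ClassX9im`".  The step to (im) is now the tree
theorem `X9.bigIm_of_surj` (`X9/SurjBigImage.lean`: `p ≥ 5`, `ρ̄_{E,p}` onto ⟹ (im)).  Hence
(theorems only):

* `classX9im_iff_classX9` — the printed X9 (`¬(im)`) and the tree's X9 (`¬surj(p)`) are the SAME
  predicate on elliptic curves over `ℚ` (referee acceptance point 10, R86.4: F2 closed by a lemma
  `Surj W p → BigIm W p`, `p ≥ 5`, rather than left as a named empty cell);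
* `residual_iff_residualV3_or_classX11b` — `Residual W p ↔ (ClassX1 ∨ … ∨ ClassX12) ∨ ClassX11b`
  (X9im folds into X9, X11a into the tree's X11 by `ClassX11a.toX11`); so the statement of record
  needs exactly ONE class beyond the tree's v3 list: X11b (finding F1, the withdrawn C4's domain);
* `partition_residualV3_or_classX11b` — `r_an ≤ 1 → Covered ∨ (ClassX1 ∨ … ∨ ClassX12) ∨ ClassX11b`;
* `formerC4_of_not_covered_of_not_residualV3` — a pair of analytic rank `≤ 1` outside every
  covered row and every tree class is a rank-one multiplicative irreducible semistable non-CM pair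
  at `p ≥ 5` with a (ram) witness (the F1 shape) — the F2 alternative of
  `gap_of_not_covered_of_not_residualV3` cannot occur;
* `bsdp_or_residualV3_or_classX11b` — `Partition/Bsdp.lean`'s `bsdp_or_residual` (granted the 14
  named published facts of the covered rows) with the same sharpened remainder.

References: RESIDUAL-CASES.md §a.0 ("(im) … implied by surj(p), p ≥ 5"), §a.2 rows X9, X11b;
HOME/PARTITION.md §5.2; REFEREE.md R86.4.
-/

namespace Summit.BirchSwinnertonDyer.Rank1Residual

open WeierstrassCurve Literature.NumberTheory.EllipticCurves
  Literature.NumberTheory.EllipticCurves.Rank1Residual Literature.NumberTheory.EllipticCurves.ModularForms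
open scoped NumberField

section Curve

variable (W : WeierstrassCurve ℚ) [W.IsElliptic] [W.IsGloballyMinimal] (p : ℕ) [Fact p.Prime]

/-- **X9 as printed = X9 as typed.**  `ClassX9im W p` (¬cm ∧ ord(p) ∧ `p ≥ 5` ∧ irr(p) ∧ ¬(im) ∧
(r = 1 → ¬sst)) ⟺ `ClassX9 W p` (the same with `¬surj(p)`): `→` by `X9.bigIm_of_surj` (`p ≥ 5`,
surj ⟹ (im)), `←` by `not_bigIm_of_irr_of_not_surj` (irr ∧ ¬surj ⟹ ¬(im)). Closes finding F2 of
the partition lemma (referee acceptance point 10, R86.4). [folklore] -/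
theorem classX9im_iff_classX9 : ClassX9im W p ↔ ClassX9 W p := by
  constructor
  · rintro ⟨hcm, hord, h5, hirr, hnim, hr⟩
    exact ⟨hcm, hord, h5, hirr, fun hs ↦ hnim (X9.bigIm_of_surj W p h5 hs), hr⟩
  · exact fun h ↦ ClassX9.toX9im h

variable {W p} in
/-- The printed X9 implies the tree's X9 (dot-notation form of `classX9im_iff_classX9`). [folklore] -/
theorem ClassX9im.toX9 (h : ClassX9im W p) : ClassX9 W p := (classX9im_iff_classX9 W p).mp h

/-- **The residual disjunction needs one class beyond the tree's v3 list, not three**: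
`Residual W p ↔ (ClassX1 ∨ … ∨ ClassX12) ∨ ClassX11b` — `ClassX9im` folds into `ClassX9`
(`classX9im_iff_classX9`) and `ClassX11a` into `ClassX11` (`ClassX11a.toX11`); `ClassX11b`
(rank-one multiplicative irreducible, containing the withdrawn C4's domain — finding F1) remains.
[folklore] -/
theorem residual_iff_residualV3_or_classX11b :
    Residual W p ↔
      (ClassX1 W p ∨ ClassX2 W p ∨ ClassX3 W p ∨ ClassX4 W p ∨ ClassX5 W p ∨ ClassX6 W p ∨
        ClassX7 W p ∨ ClassX8 W p ∨ ClassX9 W p ∨ ClassX10 W p ∨ ClassX11 W p ∨ ClassX12 W p) ∨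
      ClassX11b W p := by
  constructor
  · rintro (h | h | h | h | h | h | h | h | h | h | h | h | h | h | h)
    · exact Or.inl (Or.inl h)
    · exact Or.inl (Or.inr <| Or.inl h)
    · exact Or.inl (Or.inr <| Or.inr <| Or.inl h)
    · exact Or.inl (Or.inr <| Or.inr <| Or.inr <| Or.inl h)
    · exact Or.inl (Or.inr <| Or.inr <| Or.inr <| Or.inr <| Or.inl h)
    · exact Or.inl (Or.inr <| Or.inr <| Or.inr <| Or.inr <| Or.inr <| Or.inl h)
    · exact Or.inl (Or.inr <| Or.inr <| Or.inr <| Or.inr <| Or.inr <| Or.inr <| Or.inl h)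
    · exact Or.inl (Or.inr <| Or.inr <| Or.inr <| Or.inr <| Or.inr <| Or.inr <| Or.inr <| Or.inl h)
    · exact Or.inl (Or.inr <| Or.inr <| Or.inr <| Or.inr <| Or.inr <| Or.inr <| Or.inr <| Or.inr <|
        Or.inl h)
    · exact Or.inl (Or.inr <| Or.inr <| Or.inr <| Or.inr <| Or.inr <| Or.inr <| Or.inr <| Or.inr <|
        Or.inr <| Or.inl h)
    · exact Or.inl (Or.inr <| Or.inr <| Or.inr <| Or.inr <| Or.inr <| Or.inr <| Or.inr <| Or.inr <|
        Or.inr <| Or.inr <| Or.inl h)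
    · exact Or.inl (Or.inr <| Or.inr <| Or.inr <| Or.inr <| Or.inr <| Or.inr <| Or.inr <| Or.inr <|
        Or.inr <| Or.inr <| Or.inr h)
    · exact Or.inl (Or.inr <| Or.inr <| Or.inr <| Or.inr <| Or.inr <| Or.inr <| Or.inr <| Or.inr <|
        Or.inl h.toX9)
    · exact Or.inl (Or.inr <| Or.inr <| Or.inr <| Or.inr <| Or.inr <| Or.inr <| Or.inr <| Or.inr <|
        Or.inr <| Or.inr <| Or.inl h.toX11)
    · exact Or.inr h
  · rintro ((h | h | h | h | h | h | h | h | h | h | h | h) | h)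
    · exact Or.inl h
    · exact Or.inr <| Or.inl h
    · exact Or.inr <| Or.inr <| Or.inl h
    · exact Or.inr <| Or.inr <| Or.inr <| Or.inl h
    · exact Or.inr <| Or.inr <| Or.inr <| Or.inr <| Or.inl h
    · exact Or.inr <| Or.inr <| Or.inr <| Or.inr <| Or.inr <| Or.inl h
    · exact Or.inr <| Or.inr <| Or.inr <| Or.inr <| Or.inr <| Or.inr <| Or.inl h
    · exact Or.inr <| Or.inr <| Or.inr <| Or.inr <| Or.inr <| Or.inr <| Or.inr <| Or.inl h
    · exact Or.inr <| Or.inr <| Or.inr <| Or.inr <| Or.inr <| Or.inr <| Or.inr <| Or.inr <| Or.inl h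
    · exact Or.inr <| Or.inr <| Or.inr <| Or.inr <| Or.inr <| Or.inr <| Or.inr <| Or.inr <| Or.inr <|
        Or.inl h
    · exact Or.inr <| Or.inr <| Or.inr <| Or.inr <| Or.inr <| Or.inr <| Or.inr <| Or.inr <| Or.inr <|
        Or.inr <| Or.inl h
    · exact Or.inr <| Or.inr <| Or.inr <| Or.inr <| Or.inr <| Or.inr <| Or.inr <| Or.inr <| Or.inr <|
        Or.inr <| Or.inr <| Or.inl h
    · exact Or.inr <| Or.inr <| Or.inr <| Or.inr <| Or.inr <| Or.inr <| Or.inr <| Or.inr <| Or.inr <|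
        Or.inr <| Or.inr <| Or.inr <| Or.inr <| Or.inr h

/-- **The partition with the sharpened remainder**: every pair of analytic rank `≤ 1` lies in a
covered row, in one of the tree's v3 classes X1–X12, or in X11b. [folklore] -/
theorem partition_residualV3_or_classX11b (hr : W.analyticRank ≤ 1) :
    Covered W p ∨
      (ClassX1 W p ∨ ClassX2 W p ∨ ClassX3 W p ∨ ClassX4 W p ∨ ClassX5 W p ∨ ClassX6 W p ∨
        ClassX7 W p ∨ ClassX8 W p ∨ ClassX9 W p ∨ ClassX10 W p ∨ ClassX11 W p ∨ ClassX12 W p) ∨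
      ClassX11b W p := by
  rcases partition (W := W) (p := p) hr with h | h
  · exact Or.inl h
  · exact Or.inr ((residual_iff_residualV3_or_classX11b W p).mp h)

/-- **Where the tree's v3 classes leave a hole, it is the former-C4 shape ONLY** (finding F1): a
pair of analytic rank `≤ 1` in no covered row and in none of X1–X12 is a rank-one pair at a
multiplicative `p ≥ 5` with `E[p]` irreducible, a (ram) witness, `E` semistable and non-CM, lying
in X11b.  The second alternative of `gap_of_not_covered_of_not_residualV3` (surj ∧ ¬(im), finding
F2) is excluded by `X9.not_surj_and_not_bigIm`. [folklore] -/
theorem formerC4_of_not_covered_of_not_residualV3 (hr : W.analyticRank ≤ 1) (hc : ¬ Covered W p)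
    (hx : ¬ (ClassX1 W p ∨ ClassX2 W p ∨ ClassX3 W p ∨ ClassX4 W p ∨ ClassX5 W p ∨ ClassX6 W p ∨
      ClassX7 W p ∨ ClassX8 W p ∨ ClassX9 W p ∨ ClassX10 W p ∨ ClassX11 W p ∨ ClassX12 W p)) :
    Mult W p ∧ Irr W p ∧ W.analyticRank = 1 ∧ Ram W p ∧ Semistable W ∧ 5 ≤ p ∧ ¬ W.HasCM ∧
      ClassX11b W p := by
  rcases gap_of_not_covered_of_not_residualV3 (W := W) (p := p) hr hc hx with h | ⟨-, -, h5, hs, hnim, -⟩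
  · exact h
  · exact absurd ⟨hs, hnim⟩ (X9.not_surj_and_not_bigIm W p h5)

/-- **`BSD(E,p)` or a residual class, sharpened**: granted the named published facts behind the
covered rows (exactly the hypotheses of `bsdp_or_residual`, `Partition/Bsdp.lean`), every pair of
analytic rank `≤ 1` satisfies `BSDp W p` or lies in one of X1–X12 or in X11b. [folklore] -/
theorem bsdp_or_residualV3_or_classX11b (hSk : Skinner2016.thmC_padicValRat_bsd_rank_zero)
    (hBCS : BurungaleCastellaSkinner2025.cor131_padicValRat_bsd_rank_le_one)
    (hJSW : JetchevSkinnerWan2017.thm121_padicValRat_bsd_rank_one)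
    (hCGS : CastellaGrossiSkinner2025.thmD_padicValRat_bsd_rank_le_one)
    (hGV : GreenbergVatsal2000.thm13_charIdeal_eq_of_gvPar) (hGr : greenberg_charValue_rankZero)
    (hmod : hasEntireLFunction_rat) (hmodP : nonempty_modularParametrizationData)
    (hGZK : rank_eq_analyticRank_of_analyticRank_le_one)
    (hCM : bsdTriple_of_hasCM_of_L_one_ne_zero) (hKob : Kobayashi2013.cor14_bsdp_of_cm_rank_one)
    (hYZ : YanZhu2026.thm415_padicValRat_bsd_rank_le_one)
    (hW20 : Wuthrich2014.lemma20_surjective_threeAdic_of_semistable)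
    (hLLT : LiLiuTian2024.thm11_bsdp_of_cm_rank_one)
    (hr : W.analyticRank ≤ 1) :
    BSDp W p ∨
      (ClassX1 W p ∨ ClassX2 W p ∨ ClassX3 W p ∨ ClassX4 W p ∨ ClassX5 W p ∨ ClassX6 W p ∨
        ClassX7 W p ∨ ClassX8 W p ∨ ClassX9 W p ∨ ClassX10 W p ∨ ClassX11 W p ∨ ClassX12 W p) ∨
      ClassX11b W p :=
  (bsdp_or_residual (W := W) (p := p) hSk hBCS hJSW hCGS hGV hGr hmod hmodP hGZK hCM hKob hYZ hW20 hLLT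
      hr).imp id
    (residual_iff_residualV3_or_classX11b W p).mp

/-! ### Row C2 at a surjective prime: the (im) bit is automatic (appended, x9 gen 9) -/

/-- **Row C2 needs no separate (im) bit at a surjective prime.**  Burungale–Castella–Skinner
Cor. 1.3.1's class-level hypotheses as the tree states them (`RowC2`: non-CM, `p > 3` good
ordinary, (irr), (im)) hold at every non-CM good ordinary `p ≥ 5` with `ρ̄_{E,p}` surjective:
(irr) by `irr_of_surj`, (im) by `X9.bigIm_of_surj`.  This is the census's reading of the lane
row `T-BCS` ("(im) ⇐ surj(p), `p ≥ 5`", RESIDUAL-CASES §a.0), now a kernel implication rather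
than prose. [folklore] -/
theorem rowC2_of_surj (hcm : ¬ W.HasCM) (h5 : 5 ≤ p) (hord : GoodOrd W p) (hs : Surj W p) :
    RowC2 W p :=
  ⟨hcm, by omega, hord, irr_of_surj W p hs, X9.bigIm_of_surj W p h5 hs⟩

/-- **BCS 2025 Cor. 1.3.1 at a surjective good ordinary prime `p ≥ 5`** (the lane's booking row
`T-BCS`): granted the named fact `cor131_padicValRat_bsd_rank_le_one` (PUB\*, flag
`BCS25-IMC-equiv@BSTW` travels with it) and Gross–Zagier–Kolyvagin, every non-CM pair of
analytic rank `≤ 1` at a good ordinary `p ≥ 5` with `ρ̄_{E,p}` onto satisfies `BSDp W p` — the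
printed hypothesis (im) being DISCHARGED by `X9.bigIm_of_surj`, not assumed.
[cite: BurungaleCastellaSkinner2025, Cor. 1.3.1 (p. 4)] -/
theorem bsdp_of_cor131_of_surj
    (hBCS : BurungaleCastellaSkinner2025.cor131_padicValRat_bsd_rank_le_one)
    (hGZK : rank_eq_analyticRank_of_analyticRank_le_one) (hcm : ¬ W.HasCM) (h5 : 5 ≤ p)
    (hord : GoodOrd W p) (hs : Surj W p) (hr : W.analyticRank ≤ 1) : BSDp W p :=
  RowC2.bsdp hBCS hGZK hr (rowC2_of_surj W p hcm h5 hord hs)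

end Curve

end Summit.BirchSwinnertonDyer.Rank1Residual
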